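import Literature.NumberTheory.GaloisRepresentations.PadicCoefficientsTowerTorsion
import HarnessLib

/-!
# `H²_cont(G, ℚ_l) ≠ 0` from a class of infinite order: the non-vanishing passage `ℤ/lⁱ → ℤ_l → ℚ_l`

Topic `NumberTheory/GaloisRepresentations` (continuous cohomology of profinite groups with `l`-adic
coefficients).  Converse companion of `PadicCoefficientsTowerTorsion.lean`
(`subsingleton_continuousCohomology_two_padic_of_forall_zmod`: uniformly bounded torsion at the
finite levels kills `H²_cont(G, ℚ_l)`).  For a compact (locally compact) group `G`, a prime `l`, and
the TRIVIAL representations `ℤ_l = lim ℤ/lⁱ` (`padicIntRep`, `padicIntTower`) and `ℚ_l`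
(`padicRatRep`, carrier `ULift ℚ_l` — the coefficient object of the [AbsTopI] invariant
`δ²_l(G) := dim_{ℚ_l} H²(G, ℚ_l)`, `Literature.AnabelianGeometry.AbsoluteAnabelian.deltaInv`):

* `contTwoCocycles.toPadicRat` — a continuous `ℤ_l`-valued `2`-cocycle IS a `ℚ_l`-valued one;
* **`isOfFinAddOrder_of_twoCocycleClass_toPadicRat_eq_zero`** — if its `ℚ_l`-class vanishes, its
  `ℤ_l`-class is TORSION: a bounding `ℚ_l`-cochain `b` on the compact `G` is bounded, `l^N b` is
  `ℤ_l`-valued and bounds `l^N` times the cocycle (Tate, *Relations between K₂ and Galois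
  cohomology*, §2: `H²_cont(G, ℤ_l) ⊗ ℚ = H²_cont(G, ℚ_l)` for compact `G`; NSW (2.7.x));
* **`nontrivial_continuousCohomology_two_padicRat_of_not_isOfFinAddOrder`**,
  **`rank_continuousCohomology_two_padicRat_pos_of_not_isOfFinAddOrder`** — a class of INFINITE
  order in `H²_cont(G, ℤ_l)` yields `dim_{ℚ_l} H²_cont(G, ℚ_l) ≥ 1`;
* **`exists_not_isOfFinAddOrder_of_limitClasses`** — a compatible family of classes
  `c_i ∈ H²(G, ℤ/lⁱ)` of UNBOUNDED order (`∀ n ≥ 1, ∃ i, n • c_i ≠ 0`) is the image of a class of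
  infinite order in `H²_cont(G, ℤ_l)` (surjectivity of `H²(G, lim) → lim H²`, NSW (2.7.5); no
  finiteness needed), whence **`rank_continuousCohomology_two_padicRat_pos_of_limitClasses`**.

This is the mechanism by which the proof of [AbsTopI] Thm. 2.6 (iii), second clause (S. Mochizuki,
*Topics in Absolute Anabelian Geometry I*, p. 23: "`H¹(G, Hom(R_l, ℚ_l)) ↪ … ↪ H²(Π, ℚ_l)` … hence
`δ²_l(Π) ≥ 1`") is run at the finite levels `ℤ/lⁱ` in the tree (the Hochschild–Serre edge
`HochschildSerreEdgeTorsion.lean` producing the compatible family).  Classical, undisputed; nothing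
here bears on [IUTchIII] Cor. 3.12.

## References
* J. Neukirch, A. Schmidt, K. Wingberg, *Cohomology of Number Fields*, 2nd ed. (2008), (2.7.5),
  (2.7.6), (2.3.4)–(2.3.5). [NeukirchSchmidtWingberg2008]
* J. Tate, *Relations between K₂ and Galois cohomology*, Invent. Math. 36 (1976), §2.
  [Tate1976K2]
* S. Mochizuki, *Topics in Absolute Anabelian Geometry I: Generalities*, J. Math. Sci. Univ. Tokyo 19
  (2012), Thm 2.6 (iii) and its proof p. 23. [MochizukiAbsTopI2012]
-/

noncomputable section

open CategoryTheory Function Topology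

namespace Literature.NumberTheory.GaloisRepresentations

open _root_.TopRep _root_.ContRepresentation _root_.ContinuousCohomology

/-! ### The rational `l`-adic coefficients and the rationalisation of `ℤ_l`-cocycles -/

section Rat

variable (G : Type) [Group G] [TopologicalSpace G] [IsTopologicalGroup G]
variable (l : ℕ) [Fact l.Prime]

/-- The trivial topological representation of `G` on `ℚ_l`, carried by `ULift ℚ_l` exactly as in the
[AbsTopI] invariant `δ²_l` (`deltaInv G 2 l = dim continuousCohomology 2 (padicRatRep G l)` when
`G : Type`). [cite: MochizukiAbsTopI2012, Thm 2.6 p.21] -/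
abbrev padicRatRep : TopRep.{0} ℚ_[l] G :=
  TopRep.of (ContRepresentation.trivial ℚ_[l] G (ULift.{0} ℚ_[l]))

variable {G l}

/-- **A continuous `ℤ_l`-valued `2`-cocycle is a continuous `ℚ_l`-valued `2`-cocycle** (trivial
actions; `ℤ_l ⊆ ℚ_l`). [cite: NeukirchSchmidtWingberg2008, II §7 (2.7.5)] -/
def contTwoCocycles.toPadicRat (z : contTwoCocycles (padicIntRep G l)) :
    contTwoCocycles (padicRatRep G l) :=
  ⟨⟨fun p => ULift.up ((z.1 p : ℤ_[l]) : ℚ_[l]),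
      continuous_uliftUp.comp (continuous_subtype_val.comp z.1.continuous)⟩, by
    rw [mem_contTwoCocycles_iff]
    intro σ τ υ
    apply ULift.ext
    change ((z.1 (τ, υ) : ℤ_[l]) : ℚ_[l]) + ((z.1 (σ, τ * υ) : ℤ_[l]) : ℚ_[l]) =
      ((z.1 (σ * τ, υ) : ℤ_[l]) : ℚ_[l]) + ((z.1 (σ, τ) : ℤ_[l]) : ℚ_[l])
    have h : z.1 (τ, υ) + z.1 (σ, τ * υ) = z.1 (σ * τ, υ) + z.1 (σ, τ) := z.2 σ τ υ
    exact_mod_cast congrArg (fun t : ℤ_[l] => (t : ℚ_[l])) h⟩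

omit [IsTopologicalGroup G] in
/-- Unfolding `toPadicRat`. [cite: NeukirchSchmidtWingberg2008, II §7 (2.7.5)] -/
@[simp] theorem contTwoCocycles.toPadicRat_apply (z : contTwoCocycles (padicIntRep G l)) (p : G × G) :
    (contTwoCocycles.toPadicRat z).1 p = ULift.up ((z.1 p : ℤ_[l]) : ℚ_[l]) := rfl

end Rat

/-! ### A vanishing `ℚ_l`-class has a torsion `ℤ_l`-class -/

section Torsion

variable {G : Type} [Group G] [TopologicalSpace G] [IsTopologicalGroup G] [LocallyCompactSpace G]
variable {l : ℕ} [Fact l.Prime]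

/-- **If the `ℚ_l`-class of a continuous `ℤ_l`-valued `2`-cocycle `z` of the compact group `G`
vanishes, the `ℤ_l`-class of `z` has finite order**: a continuous `ℚ_l`-valued `1`-cochain `b`
bounding `z` is bounded on `G`, `l^N b` is `ℤ_l`-valued and bounds `l^N z`, so `l^N [z] = 0`.
(The kernel of `H²_cont(G, ℤ_l) → H²_cont(G, ℚ_l)` is torsion; Tate 1976 §2.)
[cite: NeukirchSchmidtWingberg2008, Cor (2.7.6)] [cite: Tate1976K2, §2] -/
theorem isOfFinAddOrder_of_twoCocycleClass_toPadicRat_eq_zero [CompactSpace G]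
    (z : contTwoCocycles (padicIntRep G l))
    (hz : twoCocycleClass (padicRatRep G l) (contTwoCocycles.toPadicRat z) = 0) :
    IsOfFinAddOrder (twoCocycleClass (padicIntRep G l) z) := by
  have hl1 : (1 : ℝ) < l := by exact_mod_cast (Fact.out : l.Prime).one_lt
  have hl0 : (0 : ℝ) < l := lt_trans zero_lt_one hl1
  obtain ⟨b, hb⟩ := (twoCocycleClass_eq_zero_iff _ _).1 hz
  -- the bounding cochain is bounded: `‖b‖ ≤ l^N`
  have hcont : Continuous fun σ : G => (b σ).down := continuous_uliftDown.comp b.continuous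
  obtain ⟨C, hC⟩ := (isCompact_univ (X := G)).bddAbove_image
    (continuous_norm.comp hcont).continuousOn
  have hC' : ∀ σ : G, ‖(b σ).down‖ ≤ C := fun σ => hC (Set.mem_image_of_mem _ (Set.mem_univ σ))
  obtain ⟨N, hN⟩ := pow_unbounded_of_one_lt C hl1
  -- `l^N b` is `ℤ_l`-valued
  have hnorm : ∀ σ : G, ‖(l : ℚ_[l]) ^ N * (b σ).down‖ ≤ 1 := fun σ => by
    rw [norm_mul, norm_pow, Padic.norm_p]
    have h1 : ((l : ℝ)⁻¹) ^ N * ‖(b σ).down‖ ≤ ((l : ℝ)⁻¹) ^ N * (l : ℝ) ^ N :=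
      mul_le_mul_of_nonneg_left ((hC' σ).trans hN.le) (pow_nonneg (inv_nonneg.2 hl0.le) N)
    rw [inv_pow, inv_mul_cancel₀ (pow_ne_zero N hl0.ne')] at h1
    rw [inv_pow]
    exact h1
  let b' : C(G, ℤ_[l]) :=
    ⟨fun σ => ⟨(l : ℚ_[l]) ^ N * (b σ).down, hnorm σ⟩, (continuous_const.mul hcont).subtype_mk _⟩
  have hb' : ∀ σ : G, ((b' σ : ℤ_[l]) : ℚ_[l]) = (l : ℚ_[l]) ^ N * (b σ).down := fun _ => rfl
  -- `l^N z = ∂ b'` in `ℤ_l`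
  have hbd : twoCocycleClass (padicIntRep G l) (((l ^ N : ℕ) : ℤ) • z) = 0 := by
    rw [twoCocycleClass_eq_zero_iff]
    refine ⟨b', fun σ τ => ?_⟩
    have h := congrArg ULift.down (hb σ τ)
    change ((z.1 (σ, τ) : ℤ_[l]) : ℚ_[l]) = (b τ).down - (b (σ * τ)).down + (b σ).down at h
    change (((l ^ N : ℕ) : ℤ) • z.1) (σ, τ) = b' τ - b' (σ * τ) + b' σ
    apply Subtype.ext
    rw [ContinuousMap.smul_apply]
    push_cast
    rw [hb', hb', hb', ← mul_sub, ← mul_add, ← h, zsmul_eq_mul]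
    push_cast
    ring
  rw [twoCocycleClass_smul, Nat.cast_smul_eq_nsmul] at hbd
  exact isOfFinAddOrder_iff_nsmul_eq_zero.2
    ⟨l ^ N, pow_pos (Fact.out : l.Prime).pos N, hbd⟩

/-- **A class of infinite order in `H²_cont(G, ℤ_l)` has NONZERO image in `H²_cont(G, ℚ_l)`.**
[cite: NeukirchSchmidtWingberg2008, Cor (2.7.6)] [cite: Tate1976K2, §2] -/
theorem twoCocycleClass_toPadicRat_ne_zero [CompactSpace G] (z : contTwoCocycles (padicIntRep G l))
    (hz : ¬ IsOfFinAddOrder (twoCocycleClass (padicIntRep G l) z)) :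
    twoCocycleClass (padicRatRep G l) (contTwoCocycles.toPadicRat z) ≠ 0 :=
  fun h => hz (isOfFinAddOrder_of_twoCocycleClass_toPadicRat_eq_zero z h)

/-- **`H²_cont(G, ℚ_l)` is nontrivial as soon as `H²_cont(G, ℤ_l)` has a class of infinite order.**
[cite: NeukirchSchmidtWingberg2008, Cor (2.7.6)] [cite: Tate1976K2, §2] -/
theorem nontrivial_continuousCohomology_two_padicRat_of_not_isOfFinAddOrder [CompactSpace G]
    (x : continuousCohomology 2 (padicIntRep G l)) (hx : ¬ IsOfFinAddOrder x) :
    Nontrivial (continuousCohomology 2 (padicRatRep G l)) := by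
  obtain ⟨z, rfl⟩ := twoCocycleClass_surjective _ x
  exact ⟨⟨_, 0, twoCocycleClass_toPadicRat_ne_zero z hx⟩⟩

/-- Rank form: **`dim_{ℚ_l} H²_cont(G, ℚ_l) ≥ 1`** (i.e. `δ²_l(G) ≥ 1`, [AbsTopI] Thm. 2.6) as soon as
`H²_cont(G, ℤ_l)` has a class of infinite order.
[cite: MochizukiAbsTopI2012, Thm 2.6 (iii) proof p.23] [cite: Tate1976K2, §2] -/
theorem rank_continuousCohomology_two_padicRat_pos_of_not_isOfFinAddOrder [CompactSpace G]
    (x : continuousCohomology 2 (padicIntRep G l)) (hx : ¬ IsOfFinAddOrder x) :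
    0 < Module.rank ℚ_[l] (continuousCohomology 2 (padicRatRep G l)) := by
  haveI := nontrivial_continuousCohomology_two_padicRat_of_not_isOfFinAddOrder x hx
  exact rank_pos

end Torsion

/-! ### From the finite levels: compatible families of unbounded order -/

section Tower

variable {G : Type} [Group G] [TopologicalSpace G] [IsTopologicalGroup G] [LocallyCompactSpace G]
variable {l : ℕ} [Fact l.Prime]

/-- **A compatible family of classes `c_i ∈ H²(G, ℤ/lⁱ)` of unbounded order lifts to a class of
infinite order in `H²_cont(G, ℤ_l)`** (surjectivity of `H²(G, lim ℤ/lⁱ) → lim H²(G, ℤ/lⁱ)`; a lift `x`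
with `n • x = 0` would give `n • c_i = 0` for all `i`). [cite: NeukirchSchmidtWingberg2008, Thm (2.7.5)] -/
theorem exists_not_isOfFinAddOrder_of_limitClasses (c : (padicIntTower G l).limitClasses)
    (hc : ∀ n : ℕ, 0 < n → ∃ i, n • c.1 i ≠ 0) :
    ∃ x : continuousCohomology 2 (padicIntRep G l),
      (padicIntTower G l).toLimitClasses x = c ∧ ¬ IsOfFinAddOrder x := by
  obtain ⟨x, hx⟩ := (padicIntTower G l).toLimitClasses_surjective c
  refine ⟨x, hx, fun hfin => ?_⟩
  obtain ⟨n, hn, hnx⟩ := (isOfFinAddOrder_iff_nsmul_eq_zero).1 hfin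
  obtain ⟨i, hi⟩ := hc n hn
  apply hi
  have h : (padicIntTower G l).toLimitClasses (n • x) = n • c := by rw [map_nsmul, hx]
  rw [hnx, map_zero] at h
  have h' : (0 : (padicIntTower G l).limitClasses).1 i = (n • c : (padicIntTower G l).limitClasses).1 i := by
    rw [h]
  rw [ZeroMemClass.coe_zero, Pi.zero_apply, AddSubmonoidClass.coe_nsmul, Pi.smul_apply] at h'
  exact h'.symm

/-- **`dim_{ℚ_l} H²_cont(G, ℚ_l) ≥ 1` from a compatible family `c_i ∈ H²(G, ℤ/lⁱ)` of unbounded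
order** (`G` compact): the composite of the two passages `ℤ/lⁱ → ℤ_l` (towers) and `ℤ_l → ℚ_l`
(boundedness).  With `G : Type` this is `1 ≤ deltaInv G 2 l` for the [AbsTopI] invariant.
[cite: MochizukiAbsTopI2012, Thm 2.6 (iii) proof p.23] [cite: NeukirchSchmidtWingberg2008, Thm (2.7.5)] -/
theorem rank_continuousCohomology_two_padicRat_pos_of_limitClasses [CompactSpace G]
    (c : (padicIntTower G l).limitClasses)
    (hc : ∀ n : ℕ, 0 < n → ∃ i, n • c.1 i ≠ 0) :
    0 < Module.rank ℚ_[l] (continuousCohomology 2 (padicRatRep G l)) := by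
  obtain ⟨x, -, hx⟩ := exists_not_isOfFinAddOrder_of_limitClasses c hc
  exact rank_continuousCohomology_two_padicRat_pos_of_not_isOfFinAddOrder x hx

end Tower

end Literature.NumberTheory.GaloisRepresentations

end
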